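import Summits.Langlands.Langlands.Statement
import Literature.NumberTheory.EllipticCurves.FramedTateGaloisRep
import Literature.NumberTheory.Automorphic.TotallyRealModularity
import Literature.NumberTheory.Automorphic.ThorneQInfinityModular
import Literature.NumberTheory.Automorphic.AbelianTotallyRealModularity
import Literature.NumberTheory.Automorphic.ReciprocityGLnPotentialModularityTateProofs
import Literature.NumberTheory.Automorphic.GLnAdelicStructureProofs
import Literature.NumberTheory.Automorphic.TotallyRealModularityBoxImages
import Literature.NumberTheory.NumberFields.DiscrDvdOfIsSquare
import HarnessLib

/-!
# `Lines/AbelianEllipticAwayFiveSeven_special` — F3 floor witness (forward generator G4, generation 28, dial θ30 =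
# the set `T ⊆ {3,5,7}` of primes at which the ABELIAN totally real base field must be unramified).  Sorry-free.

* FAMILY `EllipticAbelianTR T := EllipticGaloisToAutomorphicOn (AbelianAwayFrom T)` and RUNG
  `AbelianEllipticAwayFiveSeven := EllipticAbelianTR {5,7}`, verbatim as in the skeleton `Lines/AbelianEllipticAwayFiveSeven.lean`.
* BRIDGE `of_isAutomorphicOfWeightZero` (generation 6, verbatim): weight-zero automorphy with Hecke polynomials
  `X² - a_w X + q_w` ⇒ the family's conclusion for `ρ_{E,ℓ}^∨` with `m = 2`.
* FLOOR `T = {3,5,7}`: `floor_yoshikawa : YoshikawaFloorText → EllipticAbelianTR {3,5,7}` — Yoshikawa 2019, Thm. 1.2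
  ("`K` abelian totally real, unramified at 3, 5, 7 ⇒ every `E/K` modular"), Hecke-polynomial rendering; the text is
  proposed VERBATIM to Literature as `Literature.NumberTheory.Automorphic.Yoshikawa2019_theorem1_2` (p207115).
  [cite: Yoshikawa2019, Thm. 1.2]
* SIDE FLOOR (a proved cell inside the top abelian rung `T = ∅`, beside the chain): `floor_thorne : ThorneFloorText →
  EllipticGaloisToAutomorphicOn CyclotomicTowerLayer` (Thorne 2019, Thm. 1, Hecke rendering, proposed as
  `Thorne2019_thm1_weightZero`; `thorneFloorText_toWeak : ThorneFloorText → Thorne2019_thm1` recovers the tree's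
  trace-only fact). [cite: Thorne2019, Thm. 1]
* REDUCTION (§R, sorry-free): `rung_of_smallImageCell : Box2022_theorem1_3 → SmallImageCell → rung` — Box 2022 Thm 1.3
  (named fact: residual images of a non-modular `E` over any totally real field) + Dedekind's discriminant theorem
  (`not_isSquare_five_of_not_dvd_discr` in tree; `seven_dvd_discr_of_cubic_root` proved here: `ζ₇ + ζ₇⁻¹ ∈ K ⇒
  7 ∣ d_K`) cut the rung to the curves with simultaneously small mod-3, mod-5, mod-7 images — the located cell.
* ORDER: `floorFamily_of_rung : rung → EllipticAbelianTR {3,5,7}` (`{5,7} ⊆ {3,5,7}`), i.e. the dial is monotone and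
  the rung sits strictly above the floor's family value; `floor ⇏ rung` (kernel real_step, BC2 probe P10/P11).
-/

noncomputable section

set_option linter.dupNamespace false

open scoped MatrixGroups Matrix NumberField Classical Polynomial
open Filter IsDedekindDomain Field Polynomial WeierstrassCurve
open Literature.NumberTheory.Automorphic Literature.NumberTheory.GaloisRepresentations
open Literature.NumberTheory.EllipticCurves
open Literature.NumberTheory.PAdicHodge
open Summit.Langlands

namespace Summit.Langlands.Langlands.Cruxes.ReciprocityUpToIrreducibility.AbelianEllipticAwayFiveSeven

/-! ## 1. The dial: classes of totally real number fields -/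

/-- `K/ℚ` is abelian: Galois with commuting automorphisms. [folklore] -/
def IsAbelianOverQ (K : Type) [Field K] [NumberField K] : Prop :=
  IsGalois ℚ K ∧ ∀ σ τ : K ≃ₐ[ℚ] K, σ * τ = τ * σ

/-- `K` is unramified at every rational prime of `T`: `p ∤ disc K` (Dedekind). [folklore] -/
def UnramifiedAtPrimes (T : Finset ℕ) (K : Type) [Field K] [NumberField K] : Prop :=
  ∀ p ∈ T, ¬ ((p : ℤ) ∣ NumberField.discr K)

/-- The class "abelian over `ℚ` and unramified at the primes of `T`". [folklore] -/
def AbelianAwayFrom (T : Finset ℕ) : ∀ (K : Type) [Field K] [NumberField K], Prop :=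
  fun K _ _ => IsAbelianOverQ K ∧ UnramifiedAtPrimes T K

/-- The class of layers of the cyclotomic `ℤ_p`-towers of `ℚ` (some prime `p`; Thorne 2019). [folklore] -/
def CyclotomicTowerLayer : ∀ (K : Type) [Field K] [NumberField K], Prop :=
  fun K _ _ => ∃ p : ℕ, p.Prime ∧ Thorne2019.IsInCyclotomicZpExtension p K

/-! ## 2. The rung family (clause (B), `n = 2`, elliptic sector, Galois-side, archimedean-free) -/

/-- **The RUNG FAMILY over a class `𝒦` of totally real fields**: for every totally real number field `K` in
the class `𝒦`, every integral Weierstrass model `E / 𝓞 K` with elliptic generic fibre, every prime `ℓ` and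
`ι : ℚ̄_ℓ ≃+* ℂ`: if `ρ := ρ_{E,ℓ}^∨` is irreducible and de Rham above `ℓ` (pinned Fontaine datum), then there
are a cuspidal automorphic representation `π` of `GL₂(𝔸_K)` and a shift `m` such that at all but finitely many
finite places `v`, `π_v` is unramified with Satake parameter `α`, `ρ` is unramified at `v` and every arithmetic
Frobenius at `v` has characteristic polynomial `arithFrobPolyOfSatake ι q_v m α` on `ρ` (verbatim the conclusion
of generation 6's `EllipticGaloisToAutomorphicTR`, whose degree hypothesis is replaced by `𝒦 K`). -/
def EllipticGaloisToAutomorphicOn (𝒦 : ∀ (K : Type) [Field K] [NumberField K], Prop) : Prop :=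
  ∀ (K : Type) [Field K] [NumberField K] [NumberField.IsTotallyReal K], 𝒦 K →
    ∀ (E : WeierstrassCurve (𝓞 K)) [(E.baseChange K).IsElliptic] (ℓ : ℕ) [Fact ℓ.Prime]
      (ι : PadicAlgCl ℓ ≃+* ℂ),
      ((E.baseChange K).framedTateGaloisRepDual ℓ).toGaloisRep.IsIrreducible →
      (∀ (v : HeightOneSpectrum (𝓞 K)) (hv : ((ℓ : ℕ) : 𝓞 K) ∈ v.asIdeal),
          (fontainePstAdicCompletion v ℓ hv).IsDeRhamFramed
            (((E.baseChange K).framedTateGaloisRepDual ℓ).toLocal v)) →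
      ∃ (hK : isCompact_glFiniteIntegralLevel 2 K) (π : CuspidalAutomorphicRepData 2 K hK) (m : ℕ),
        ∀ᶠ v : HeightOneSpectrum (𝓞 K) in Filter.cofinite, ∃ α : Multiset ℂ,
          π.1.HasSatakeParamAt v α ∧
          ((E.baseChange K).framedTateGaloisRepDual ℓ).IsUnramifiedAt v ∧
          ((E.baseChange K).framedTateGaloisRepDual ℓ).HasFrobCharpolyAt v
            (arithFrobPolyOfSatake ι v.residueCard m α)

/-- **THE DIAL as a one-parameter family**: `T ⊆ {3,5,7}` ↦ the family over abelian totally real fields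
unramified at the primes of `T`. -/
def EllipticAbelianTR (T : Finset ℕ) : Prop := EllipticGaloisToAutomorphicOn (AbelianAwayFrom T)

/-- **THE RUNG** (the filed statement): `T = {5,7}` — clause (B) for the Tate modules of elliptic curves over
every abelian totally real field unramified at `5` and `7` (ramification at `3` allowed). -/
def AbelianEllipticAwayFiveSeven : Prop := EllipticAbelianTR {5, 7}

/-- Class monotonicity: a bigger class gives a stronger statement. [folklore] -/
theorem ellipticGaloisToAutomorphicOn_mono {𝒦 𝒦' : ∀ (K : Type) [Field K] [NumberField K], Prop}
    (h𝒦 : ∀ (K : Type) [Field K] [NumberField K], 𝒦 K → 𝒦' K)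
    (h : EllipticGaloisToAutomorphicOn 𝒦') : EllipticGaloisToAutomorphicOn 𝒦 :=
  fun K _ _ _ hK => h K (h𝒦 K hK)

/-- **Dial monotonicity**: `T ⊆ T'` ⇒ `EllipticAbelianTR T → EllipticAbelianTR T'`. [folklore] -/
theorem ellipticAbelianTR_mono {T T' : Finset ℕ} (hTT' : T ⊆ T') (h : EllipticAbelianTR T) :
    EllipticAbelianTR T' :=
  ellipticGaloisToAutomorphicOn_mono (fun K _ _ hK => ⟨hK.1, fun p hp => hK.2 p (hTT' hp)⟩) h

/-- The rung implies the floor's family value (`{5,7} ⊆ {3,5,7}`): the ladder is ordered. [folklore] -/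
theorem floorFamily_of_rung (h : AbelianEllipticAwayFiveSeven) : EllipticAbelianTR {3, 5, 7} :=
  ellipticAbelianTR_mono (by decide) h

/-! ## 3. The bridge (verbatim from generation 6's `QuinticEllipticGaloisToAutomorphic_special`) -/

/-- An integral model whose generic fibre is an elliptic curve has `Δ ≠ 0`. [folklore] -/
theorem Δ_ne_zero_of_isElliptic_baseChange {K : Type} [Field K] [NumberField K]
    (E : WeierstrassCurve (𝓞 K)) [(E.baseChange K).IsElliptic] : E.Δ ≠ 0 := by
  intro h0
  have hu := (E.baseChange K).isUnit_Δ
  rw [WeierstrassCurve.baseChange, WeierstrassCurve.map_Δ, h0, map_zero] at hu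
  exact not_isUnit_zero hu

/-- **Normalisation identity** (`m = 2`). [folklore] -/
theorem arithFrobPolyOfSatake_two_pair {ℓ : ℕ} [Fact ℓ.Prime] (ι : PadicAlgCl ℓ ≃+* ℂ) (q : ℕ)
    (a : ℤ) (z₁ z₂ : ℂ) (hq : q ≠ 0)
    (hsum : ((Real.sqrt q : ℝ) : ℂ) * ({z₁, z₂} : Multiset ℂ).sum = (a : ℂ))
    (hprod : ((Real.sqrt q : ℝ) : ℂ) ^ 2 * ({z₁, z₂} : Multiset ℂ).prod = (q : ℂ)) :
    arithFrobPolyOfSatake ι q 2 {z₁, z₂} =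
      X ^ 2 - C ((a : PadicAlgCl ℓ) / (q : PadicAlgCl ℓ)) * X + C ((q : PadicAlgCl ℓ)⁻¹) := by
  have hs : ((Real.sqrt q : ℝ) : ℂ) * z₁ + ((Real.sqrt q : ℝ) : ℂ) * z₂ = a := by
    simpa [Multiset.insert_eq_cons, mul_add] using hsum
  have hp' : ((Real.sqrt q : ℝ) : ℂ) ^ 2 * (z₁ * z₂) = q := by
    simpa [Multiset.insert_eq_cons] using hprod
  have hp : (((Real.sqrt q : ℝ) : ℂ) * z₁) * (((Real.sqrt q : ℝ) : ℂ) * z₂) = q := by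
    linear_combination hp'
  have hq' : (q : ℂ) ≠ 0 := by exact_mod_cast hq
  have h1 : ((Real.sqrt q : ℝ) : ℂ) * z₁ ≠ 0 := fun h => hq' (by rw [← hp, h, zero_mul])
  have h2 : ((Real.sqrt q : ℝ) : ℂ) * z₂ ≠ 0 := fun h => hq' (by rw [← hp, h, mul_zero])
  have hinv_sum : (((Real.sqrt q : ℝ) : ℂ) * z₁)⁻¹ + (((Real.sqrt q : ℝ) : ℂ) * z₂)⁻¹ = (a : ℂ) / q := by
    rw [inv_add_inv h1 h2, hs, hp]
  have hinv_prod : (((Real.sqrt q : ℝ) : ℂ) * z₁)⁻¹ * (((Real.sqrt q : ℝ) : ℂ) * z₂)⁻¹ = ((q : ℂ))⁻¹ := by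
    rw [← mul_inv, hp]
  unfold arithFrobPolyOfSatake
  simp only [Multiset.insert_eq_cons, Multiset.map_cons, Multiset.map_singleton, Multiset.prod_cons,
    Multiset.prod_singleton, Nat.reduceSub, pow_one]
  rw [X_sub_C_mul_X_sub_C, ← map_add ι.symm, ← map_mul ι.symm, hinv_sum, hinv_prod, map_div₀,
    map_inv₀, map_intCast, map_natCast]

/-- **THE BRIDGE**: weight-zero automorphy of the model (`IsAutomorphicOfWeightZero`) gives the family's
conclusion for `ρ_{E,ℓ}^∨` with `m = 2`. [folklore] -/
theorem of_isAutomorphicOfWeightZero {K : Type} [Field K] [NumberField K]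
    {E : WeierstrassCurve (𝓞 K)} [(E.baseChange K).IsElliptic]
    (hE : IsAutomorphicOfWeightZero E) (ℓ : ℕ) [Fact ℓ.Prime] (ι : PadicAlgCl ℓ ≃+* ℂ) :
    ∃ (hK : isCompact_glFiniteIntegralLevel 2 K) (π : CuspidalAutomorphicRepData 2 K hK) (m : ℕ),
      ∀ᶠ v : HeightOneSpectrum (𝓞 K) in Filter.cofinite, ∃ α : Multiset ℂ,
        π.1.HasSatakeParamAt v α ∧
        ((E.baseChange K).framedTateGaloisRepDual ℓ).IsUnramifiedAt v ∧
        ((E.baseChange K).framedTateGaloisRepDual ℓ).HasFrobCharpolyAt v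
          (arithFrobPolyOfSatake ι v.residueCard m α) := by
  have hΔ : E.Δ ≠ 0 := Δ_ne_zero_of_isElliptic_baseChange E
  obtain ⟨hK, π, -, hH⟩ := hE
  refine ⟨hK, π, 2, ?_⟩
  have hc : Continuous fun x : Field.absoluteGaloisGroup K × (E.baseChange K).rationalTateModule ℓ =>
      Literature.NumberTheory.EllipticCurves.rationalTateRepresentation (Field.absoluteGaloisGroup K)
        (WeierstrassCurve.geomPoints (E.baseChange K)) ℓ x.1 x.2 :=
    (E.baseChange K).continuous_rationalGaloisRepTate_holds ℓ
  haveI hfin : Module.Finite ℚ_[ℓ] ((E.baseChange K).rationalTateModule ℓ) :=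
    (E.baseChange K).module_finite_rationalTateModule_holds ℓ
  filter_upwards [eventually_not_mem_asIdeal hΔ,
    eventually_natCast_not_mem_asIdeal K (Fact.out : ℓ.Prime).ne_zero] with v hvΔ hvℓ
  obtain ⟨α, hα, hsum, hprod⟩ := exists_hasSatakeParamAt_of_hasHeckePolynomialAt_frobPoly (hH v hvΔ)
  have hgood : (E.baseChange K).HasGoodReductionAt v := hasGoodReductionAt_baseChange_of_Δ_not_mem hvΔ
  have hF := hasFrobCharpolyAt_rationalTateGaloisRepOf_of_hasGoodReductionAt
    ((E.baseChange K).trace_galoisRepTate_frobenius_of_hasGoodReductionAt_holds ℓ)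
    ((E.baseChange K).det_galoisRepTate_frobenius_of_hasGoodReductionAt_holds ℓ) hc hvℓ hgood
  rw [frobeniusTraceAt_baseChange_eq_frobTraceAt hvΔ, natCard_residueField_eq_residueCard] at hF
  have hD := (E.baseChange K).hasFrobCharpolyAt_framedTateGaloisRepDual ℓ hc hF
  simp only [map_intCast, map_natCast] at hD
  refine ⟨α, hα, (E.baseChange K).isUnramifiedAt_framedTateGaloisRepDual ℓ hgood hvℓ, ?_⟩
  obtain ⟨z₁, z₂, rfl⟩ := Multiset.card_eq_two.1 hα.card_eq
  rw [arithFrobPolyOfSatake_two_pair ι v.residueCard (frobTraceAt E v) z₁ z₂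
    (by have := v.one_lt_residueCard; omega)
    hsum hprod]
  exact hD

/-! ## 4. The floors (F3): named facts, Hecke-polynomial rendering, as hypotheses -/

/-- **Yoshikawa 2019, Thm. 1.2** — "Let `K` be a totally real number field which is abelian over `ℚ`.
Suppose that `K` is unramified at every prime above 3, 5, and 7. Then, any elliptic curve over `K` is
modular."  Rendered as the tree renders FLS 2015 Thm. 1 (`FLS2015_theorem1`): every integral model with
`Δ ≠ 0` is automorphic of weight zero (`IsAutomorphicOfWeightZero`); "unramified at every prime above `p`"
= `p ∤ disc K` (Dedekind).  Vendored in parallel as `Literature.NumberTheory.Automorphic.Yoshikawa2019_theorem1_2`.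
[cite: Yoshikawa2019, Thm. 1.2] -/
def YoshikawaFloorText : Prop :=
  ∀ (K : Type) [Field K] [NumberField K] [NumberField.IsTotallyReal K], IsGalois ℚ K →
    (∀ σ τ : K ≃ₐ[ℚ] K, σ * τ = τ * σ) →
    ¬ ((3 : ℤ) ∣ NumberField.discr K) → ¬ ((5 : ℤ) ∣ NumberField.discr K) →
    ¬ ((7 : ℤ) ∣ NumberField.discr K) →
    ∀ E : WeierstrassCurve (𝓞 K), E.Δ ≠ 0 → IsAutomorphicOfWeightZero E

/-- **Thorne 2019, Thm. 1**, Hecke-polynomial rendering (the tree's `Thorne2019_thm1` is the trace-only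
rendering of the same printed theorem). Vendored in parallel as
`Literature.NumberTheory.Automorphic.Thorne2019_thm1_weightZero`. [cite: Thorne2019, Thm. 1] -/
def ThorneFloorText : Prop :=
  ∀ (p : ℕ), p.Prime → ∀ (K : Type) [Field K] [NumberField K],
    Thorne2019.IsInCyclotomicZpExtension p K →
      ∀ E : WeierstrassCurve (𝓞 K), E.Δ ≠ 0 → IsAutomorphicOfWeightZero E

/-- The Hecke rendering implies the tree's trace-only rendering `Thorne2019_thm1`. [cite: Thorne2019, Thm. 1] -/
theorem thorneFloorText_toWeak (h : ThorneFloorText) : Thorne2019_thm1 :=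
  fun p hp K _ _ hK E hE =>
    (IsHilbertModular.of_isAutomorphicOfWeightZero hE (h p hp K hK E hE)).isModularEllipticCurve

/-- **FLOOR `T = {3,5,7}` = THE F3 WITNESS**: the family at the floor value is Yoshikawa's theorem up to the
bridge. [cite: Yoshikawa2019, Thm. 1.2] -/
theorem floor_yoshikawa (h : YoshikawaFloorText) : EllipticAbelianTR {3, 5, 7} := by
  intro K _ _ _ hK E _ ℓ _ ι _ _
  obtain ⟨⟨hG, hcomm⟩, hT⟩ := hK
  have h3 : ¬ ((3 : ℤ) ∣ NumberField.discr K) := by exact_mod_cast hT 3 (by simp)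
  have h5 : ¬ ((5 : ℤ) ∣ NumberField.discr K) := by exact_mod_cast hT 5 (by simp)
  have h7 : ¬ ((7 : ℤ) ∣ NumberField.discr K) := by exact_mod_cast hT 7 (by simp)
  exact of_isAutomorphicOfWeightZero (h K hG hcomm h3 h5 h7 E (Δ_ne_zero_of_isElliptic_baseChange E)) ℓ ι

/-- **Side floor** (a proved cell inside the top abelian rung): the layers of the cyclotomic `ℤ_p`-towers of
`ℚ`. [cite: Thorne2019, Thm. 1] -/
theorem floor_thorne (h : ThorneFloorText) : EllipticGaloisToAutomorphicOn CyclotomicTowerLayer := by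
  intro K _ _ _ hK E _ ℓ _ ι _ _
  obtain ⟨p, hp, hKp⟩ := hK
  exact of_isAutomorphicOfWeightZero (h p hp K hKp E (Δ_ne_zero_of_isElliptic_baseChange E)) ℓ ι

/-- F3 in the brief's literal shape. -/
example (h : YoshikawaFloorText) : EllipticAbelianTR {3, 5, 7} := floor_yoshikawa h



/-! ### The floors from the vendored Literature facts BY NAME (p207115, commit c7dddbb035f1) -/

/-- The local floor text IS the vendored fact `Yoshikawa2019_theorem1_2` (syntactically the same Prop). -/
theorem yoshikawaFloorText_iff :
    YoshikawaFloorText ↔ Literature.NumberTheory.Automorphic.Yoshikawa2019_theorem1_2 := Iff.rfl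

/-- The local Thorne floor text IS the vendored fact `Thorne2019_thm1_weightZero`. -/
theorem thorneFloorText_iff :
    ThorneFloorText ↔ Literature.NumberTheory.Automorphic.Thorne2019_thm1_weightZero := Iff.rfl

/-- **F3 FLOOR from the named Literature fact**: Yoshikawa 2019, Thm. 1.2 ⇒ the family at `T = {3,5,7}`.
[cite: Yoshikawa2019, Thm. 1.2] -/
theorem floor (h : Literature.NumberTheory.Automorphic.Yoshikawa2019_theorem1_2) : EllipticAbelianTR {3, 5, 7} :=
  floor_yoshikawa h

/-- **Side floor from the named Literature fact**: Thorne 2019, Thm. 1 (Hecke rendering) ⇒ the family on the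
cyclotomic-tower layers. [cite: Thorne2019, Thm. 1] -/
theorem floor_thorne_named (h : Literature.NumberTheory.Automorphic.Thorne2019_thm1_weightZero) :
    EllipticGaloisToAutomorphicOn CyclotomicTowerLayer :=
  floor_thorne h

/-! ## R. REDUCTION of the rung to its located cell (sorry-free): Box 2022 Thm 1.3 (named fact
`Box2022_theorem1_3`: residual images of a NON-modular `E` over any totally real field) + Dedekind's discriminant
theorem (`5 ∤ d_K ⇒ √5 ∉ K`, in tree; `7 ∤ d_K ⇒ ζ₇ + ζ₇⁻¹ ∉ K`, proved here) cut the rung down to the curves with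
SMALL images at 3, 5 AND 7 simultaneously. -/

section CubicSeven

open Ideal

/-- **If `θ = ζ₇ + ζ₇⁻¹ ∈ K` (a root of `X³ + X² − 2X − 1`) then `7 ∣ d_K`.**  In `ℤ[θ]`:
`(2 − θ)³ (θ² + 2θ)² = 7` and `(θ − 1)(θ² + 2θ) = 1`, so `θ² + 2θ` is a unit, every prime `Q ∋ 7` of `𝓞 K`
contains `2 − θ`, hence `7 ∈ Q²`, `Q` is ramified over `7`, and Dedekind's discriminant theorem gives `7 ∣ d_K`
(same argument as `Literature.NumberTheory.NumberFields.dvd_discr_of_isSquare_natCast`). [folklore] -/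
theorem seven_dvd_discr_of_cubic_root (K : Type*) [Field K] [NumberField K] {x : K}
    (hx : x ^ 3 + x ^ 2 - 2 * x - 1 = 0) : (7 : ℤ) ∣ NumberField.discr K := by
  classical
  have hp : Nat.Prime 7 := by norm_num
  have hpZ : Prime (7 : ℤ) := Nat.prime_iff_prime_int.mp hp
  -- `x` is an algebraic integer
  have hxint : IsIntegral ℤ x := by
    refine ⟨Polynomial.X ^ 3 + Polynomial.X ^ 2 - 2 * Polynomial.X - 1, ?_, ?_⟩
    · have : (Polynomial.X ^ 3 + Polynomial.X ^ 2 - 2 * Polynomial.X - 1 : Polynomial ℤ) =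
          Polynomial.X ^ 3 + (Polynomial.X ^ 2 - 2 * Polynomial.X - 1) := by ring
      rw [this]
      refine Polynomial.Monic.add_of_left (Polynomial.monic_X_pow 3) ?_
      refine lt_of_le_of_lt (Polynomial.degree_sub_le _ _) ?_
      rw [Polynomial.degree_X_pow]
      refine max_lt ?_ ?_
      · refine lt_of_le_of_lt (Polynomial.degree_sub_le _ _) (max_lt ?_ ?_)
        · rw [Polynomial.degree_X_pow]; norm_num
        · refine lt_of_le_of_lt (Polynomial.degree_mul_le _ _) ?_
          have h2 : Polynomial.degree (2 : Polynomial ℤ) = 0 := Polynomial.degree_C (show (2 : ℤ) ≠ 0 by norm_num)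
          rw [h2, Polynomial.degree_X]; norm_num
      · simp
    · simp only [Polynomial.eval₂_sub, Polynomial.eval₂_add, Polynomial.eval₂_X_pow, Polynomial.eval₂_mul,
        Polynomial.eval₂_X, Polynomial.eval₂_one, Polynomial.eval₂_ofNat]
      exact hx
  obtain ⟨t, ht⟩ := (IsIntegralClosure.isIntegral_iff (A := 𝓞 K)).mp hxint
  have hinj := IsIntegralClosure.algebraMap_injective (𝓞 K) ℤ K
  -- the two identities in `𝓞 K`
  have hsu : (2 - t) ^ 3 * (t ^ 2 + 2 * t) ^ 2 = (7 : 𝓞 K) := by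
    apply hinj
    simp only [map_mul, map_pow, map_sub, map_add, map_ofNat, ht]
    linear_combination (-x ^ 4 + 3 * x ^ 3 + 3 * x ^ 2 - 14 * x + 7) * hx
  have hunit : (t - 1) * (t ^ 2 + 2 * t) = 1 := by
    apply hinj
    simp only [map_mul, map_pow, map_sub, map_add, map_ofNat, map_one, ht]
    linear_combination hx
  -- a prime `Q` of `𝓞 K` above `7`
  have hp0 : Ideal.span {(7 : ℤ)} ≠ ⊥ := by
    rw [Ne, Ideal.span_singleton_eq_bot]; exact hpZ.ne_zero
  haveI hpmax : (Ideal.span {(7 : ℤ)}).IsMaximal :=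
    ((Ideal.span_singleton_prime hpZ.ne_zero).mpr hpZ).isMaximal hp0
  obtain ⟨Q, hQmax, hQover⟩ :=
    Ideal.exists_maximal_ideal_liesOver_of_isIntegral (S := 𝓞 K) (Ideal.span {(7 : ℤ)})
  haveI := hQmax.isPrime
  have hpQ : (7 : 𝓞 K) ∈ Q := by
    have h1 : (7 : ℤ) ∈ Ideal.span {(7 : ℤ)} := Ideal.mem_span_singleton_self _
    have h2 := (Ideal.mem_of_liesOver Q (Ideal.span {(7 : ℤ)}) (7 : ℤ)).mp h1
    simpa using h2
  -- `t² + 2t` is a unit, so `2 - t ∈ Q`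
  have huQ : t ^ 2 + 2 * t ∉ Q := by
    intro hu
    have : (1 : 𝓞 K) ∈ Q := by rw [← hunit]; exact Q.mul_mem_left _ hu
    exact hQmax.ne_top ((Ideal.eq_top_iff_one Q).mpr this)
  have hsQ : 2 - t ∈ Q := by
    have h7 : (2 - t) ^ 3 * (t ^ 2 + 2 * t) ^ 2 ∈ Q := by rw [hsu]; exact hpQ
    rcases Ideal.IsPrime.mem_or_mem inferInstance h7 with h | h
    · exact Ideal.IsPrime.mem_of_pow_mem inferInstance 3 h
    · exact absurd (Ideal.IsPrime.mem_of_pow_mem inferInstance 2 h) huQ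
  have hle2 : (Ideal.span {(7 : ℤ)}).map (algebraMap ℤ (𝓞 K)) ≤ Q ^ 2 := by
    rw [Ideal.map_span, Set.image_singleton, Ideal.span_le, Set.singleton_subset_iff, SetLike.mem_coe]
    have : (algebraMap ℤ (𝓞 K)) 7 = (2 - t) * (2 - t) * ((2 - t) * (t ^ 2 + 2 * t) ^ 2) := by
      rw [map_ofNat, ← hsu]; ring
    rw [this, sq]
    exact Ideal.mul_mem_right _ _ (Ideal.mul_mem_mul hsQ hsQ)
  have hle1 : (Ideal.span {(7 : ℤ)}).map (algebraMap ℤ (𝓞 K)) ≤ Q :=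
    hle2.trans (Ideal.pow_le_self two_ne_zero)
  have hne : Ideal.ramificationIdx' (Ideal.span {(7 : ℤ)}) Q ≠ 1 :=
    (Ideal.ramificationIdx'_ne_one_iff hle1).mpr hle2
  by_contra hnd
  haveI hunr : Algebra.IsUnramifiedAt ℤ Q :=
    (NumberField.not_dvd_discr_iff_forall_mem K (𝓞 K) hpZ).mp hnd Q inferInstance
      (by exact_mod_cast hpQ)
  have h1 : Q.ramificationIdx ℤ = 1 := Ideal.ramificationIdx_eq_one Q ℤ
  rw [← Ideal.ramificationIdx'_eq_ramificationIdx (Ideal.span {(7 : ℤ)}) Q hp0] at h1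
  exact hne h1

/-- **If `7 ∤ d_K` then `X³ + X² − 2X − 1` has no root in `K`** (`K ∩ ℚ(ζ₇) = ℚ`, the hypothesis of Box 2022
Thm 1.3 (iii)). [folklore] -/
theorem cubic7_ne_zero_of_not_dvd_discr (K : Type*) [Field K] [NumberField K]
    (h7 : ¬ ((7 : ℤ) ∣ NumberField.discr K)) : ∀ x : K, x ^ 3 + x ^ 2 - 2 * x - 1 ≠ 0 :=
  fun _ hx => h7 (seven_dvd_discr_of_cubic_root K hx)

end CubicSeven

/-- Box's mod-`3` smallness for `E`: some framing of `E[3]` has image in `B(3)` or in `C_s⁺(3)` (clause (i) of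
`Box2022_theorem1_3`, verbatim). -/
def ModThreeSmall (K : Type) [Field K] [NumberField K] (E : WeierstrassCurve (𝓞 K)) : Prop :=
  ∃ ρ : FramedGaloisRep K (ZMod 3) 2, (E.baseChange K).IsTorsionGaloisRep 3 ρ ∧
    ((∀ σ : Field.absoluteGaloisGroup K,
        ((ρ σ : GL (Fin 2) (ZMod 3)) : Matrix (Fin 2) (Fin 2) (ZMod 3)) 1 0 = 0) ∨
      (∀ σ : Field.absoluteGaloisGroup K, (ρ σ : GL (Fin 2) (ZMod 3)) ∈
        Subgroup.closure ({(⟨!![1, 0; 0, 2], !![1, 0; 0, 2], by decide, by decide⟩ :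
            GL (Fin 2) (ZMod 3)),
          (⟨!![0, 1; 1, 0], !![0, 1; 1, 0], by decide, by decide⟩ : GL (Fin 2) (ZMod 3))} :
          Set (GL (Fin 2) (ZMod 3)))))

/-- Box's mod-`5` smallness: some framing of `E[5]` has image in `B(5)` (clause (ii), verbatim). -/
def ModFiveBorel (K : Type) [Field K] [NumberField K] (E : WeierstrassCurve (𝓞 K)) : Prop :=
  ∃ ρ : FramedGaloisRep K (ZMod 5) 2, (E.baseChange K).IsTorsionGaloisRep 5 ρ ∧
    ∀ σ : Field.absoluteGaloisGroup K,
      ((ρ σ : GL (Fin 2) (ZMod 5)) : Matrix (Fin 2) (Fin 2) (ZMod 5)) 1 0 = 0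

/-- Box's mod-`7` smallness: some framing of `E[7]` has image in `B(7)` or in `G(e7)` (clause (iii), verbatim). -/
def ModSevenSmall (K : Type) [Field K] [NumberField K] (E : WeierstrassCurve (𝓞 K)) : Prop :=
  ∃ ρ : FramedGaloisRep K (ZMod 7) 2, (E.baseChange K).IsTorsionGaloisRep 7 ρ ∧
    ((∀ σ : Field.absoluteGaloisGroup K,
        ((ρ σ : GL (Fin 2) (ZMod 7)) : Matrix (Fin 2) (Fin 2) (ZMod 7)) 1 0 = 0) ∨
      (∀ σ : Field.absoluteGaloisGroup K, (ρ σ : GL (Fin 2) (ZMod 7)) ∈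
        Subgroup.closure ({(⟨!![0, 5; 3, 0], !![0, 5; 3, 0], by decide, by decide⟩ :
            GL (Fin 2) (ZMod 7)),
          (⟨!![5, 0; 3, 2], !![3, 0; 6, 4], by decide, by decide⟩ : GL (Fin 2) (ZMod 7))} :
          Set (GL (Fin 2) (ZMod 7)))))

/-- **THE LOCATED CELL of the rung** (Hecke rendering): every integral model `E / 𝓞 K` with `Δ ≠ 0` over an
abelian totally real `K` with `5 ∤ d_K`, `7 ∤ d_K` (3 arbitrary) whose mod-3, mod-5 AND mod-7 images are
simultaneously small in Box's sense (`B(3) ∪ C_s⁺(3)`, `B(5)`, `B(7) ∪ G(e7)`) is automorphic of weight zero.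
This is where Yoshikawa's proof stops when `3 ∣ d_K` ([Fr] Thm 5.1 = Skinner–Wiles needs `3 ∤ d_K`). -/
def SmallImageCell : Prop :=
  ∀ (K : Type) [Field K] [NumberField K] [NumberField.IsTotallyReal K], IsAbelianOverQ K →
    ¬ ((5 : ℤ) ∣ NumberField.discr K) → ¬ ((7 : ℤ) ∣ NumberField.discr K) →
    ∀ E : WeierstrassCurve (𝓞 K), E.Δ ≠ 0 →
      ModThreeSmall K E → ModFiveBorel K E → ModSevenSmall K E → IsAutomorphicOfWeightZero E

/-- **Box 2022 Thm 1.3 + the cell ⇒ weight-zero automorphy of every `E` in the rung's class.** [folklore] -/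
theorem isAutomorphicOfWeightZero_of_cell (hB : Box2022_theorem1_3) (hc : SmallImageCell)
    (K : Type) [Field K] [NumberField K] [NumberField.IsTotallyReal K] (hab : IsAbelianOverQ K)
    (h5 : ¬ ((5 : ℤ) ∣ NumberField.discr K)) (h7 : ¬ ((7 : ℤ) ∣ NumberField.discr K))
    (E : WeierstrassCurve (𝓞 K)) (hΔ : E.Δ ≠ 0) : IsAutomorphicOfWeightZero E := by
  by_contra hne
  obtain ⟨h3, h5', h7'⟩ := hB K E hΔ hne
  exact hne (hc K hab h5 h7 E hΔ h3
    (h5' (Literature.NumberTheory.NumberFields.not_isSquare_five_of_not_dvd_discr K h5))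
    (h7' (cubic7_ne_zero_of_not_dvd_discr K h7)))

/-- **REDUCTION (sorry-free): the rung follows from the named fact `Box2022_theorem1_3` and its located cell.**
The first lemma of the line, proved: what remains of `stub_rung` is exactly `SmallImageCell`. [folklore] -/
theorem rung_of_smallImageCell (hB : Box2022_theorem1_3) (hc : SmallImageCell) :
    AbelianEllipticAwayFiveSeven := by
  intro K _ _ _ hK E _ ℓ _ ι _ _
  obtain ⟨hab, hT⟩ := hK
  have h5 : ¬ ((5 : ℤ) ∣ NumberField.discr K) := by exact_mod_cast hT 5 (by simp)
  have h7 : ¬ ((7 : ℤ) ∣ NumberField.discr K) := by exact_mod_cast hT 7 (by simp)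
  exact of_isAutomorphicOfWeightZero
    (isAutomorphicOfWeightZero_of_cell hB hc K hab h5 h7 E (Δ_ne_zero_of_isElliptic_baseChange E)) ℓ ι

end Summit.Langlands.Langlands.Cruxes.ReciprocityUpToIrreducibility.AbelianEllipticAwayFiveSeven

end
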